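import Mathlib
import Summits.Ventures.PercRepro.TriangleCapRowWitness

/-!
# PercRepro — THE ROW WITNESS: THE INTERSECTING PAIRS ARE THE COLLISIONS OF THE LEFT ENDS, AND THE VALUE (p3,
gen 51; part 237b)

For the row witness of part 237 two off-pairs share a vertex iff they share their left end (the right ends are
distinct and never a left end), so `offAdjPairs H 0 = coll t lf` (`offAdjPairs_rowWitness`), and with the vertex
decomposition and the bipartite spectrum the value is (`rowWitness_value`)
`Σ d² + r (n − 1 − r) + (2 t (r − t − 1) + 2 (t − m) + (t (t − 1) − coll t lf)) = |E| n`.  Axioms: standard.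
-/

namespace PercRepro

namespace TriangleCap

namespace C047

open Finset

/-- **`offAdjPairs = coll t lf`:** two off-pairs share a vertex iff they share their left end. -/
theorem offAdjPairs_rowWitness (n a r t m : ℕ) (hn : 0 < n) (lf : ℕ → ℕ) (ha : 1 ≤ a)
    (hlf : ∀ i, i < t → 1 ≤ lf i ∧ lf i < a) (hr : t + m ≤ r) (han : a + r ≤ n) :
    offAdjPairs (missingGraph (rowWitness n a r t m hn lf) (leftPart n a)) (fin' n hn 0) = coll t lf := by
  unfold offAdjPairs coll
  rw [offEdges_missingGraph_rowWitness n a r t m hn lf ha hlf hr han]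
  unfold rowPairs
  -- the off-diagonal of the image is the image of the off-diagonal under the pair map
  have hinj : Set.InjOn (rowPair n a m hn lf) ↑(range t) := fun i hi i' hi' h => by
    simp only [coe_range, Set.mem_Iio] at hi hi'
    exact (rowPair_eq_iff n a r t m hn lf hlf i i' hi hi' hr han).mp h
  have hinj2 : Set.InjOn (Prod.map (rowPair n a m hn lf) (rowPair n a m hn lf)) ↑((range t).offDiag) := by
    intro p hp p' hp' h
    simp only [coe_offDiag, Set.mem_offDiag, coe_range, Set.mem_Iio] at hp hp'
    rw [Prod.ext_iff] at h ⊢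
    exact ⟨(rowPair_eq_iff n a r t m hn lf hlf _ _ hp.1 hp'.1 hr han).mp h.1,
      (rowPair_eq_iff n a r t m hn lf hlf _ _ hp.2.1 hp'.2.1 hr han).mp h.2⟩
  rw [offDiag_image_of_injOn hinj, card_filter_image_of_injOn hinj2]
  congr 1
  ext p
  simp only [mem_filter, Prod.map_fst, Prod.map_snd]
  constructor
  · rintro ⟨hp, v, hv1, hv2⟩
    refine ⟨hp, ?_⟩
    rw [mem_offDiag] at hp
    obtain ⟨hp1, hp2, hp12⟩ := hp
    rw [mem_range] at hp1 hp2
    have h1 := hlf p.1 hp1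
    have h2 := hlf p.2 hp2
    have h3 := le_rEnd n a r t m p.1 hp1 hr han
    have h4 := le_rEnd n a r t m p.2 hp2 hr han
    rw [mem_rowPair_iff n a r t m hn lf hlf _ hp1 hr han] at hv1
    rw [mem_rowPair_iff n a r t m hn lf hlf _ hp2 hr han] at hv2
    rcases hv1 with hv1 | hv1 <;> rcases hv2 with hv2 | hv2
    · omega
    · omega
    · omega
    · exact absurd (rEnd_inj n a r t m _ _ hp1 hp2 hr han (by omega)) hp12
  · rintro ⟨hp, h⟩
    refine ⟨hp, ?_⟩
    rw [mem_offDiag] at hp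
    obtain ⟨hp1, hp2, -⟩ := hp
    rw [mem_range] at hp1 hp2
    have h1 := hlf p.1 hp1
    refine ⟨fin' n hn (lf p.1), ?_, ?_⟩
    · rw [mem_rowPair_iff n a r t m hn lf hlf _ hp1 hr han, fin'_val n hn _ (by omega)]
      exact Or.inl rfl
    · rw [mem_rowPair_iff n a r t m hn lf hlf _ hp2 hr han, fin'_val n hn _ (by omega)]
      exact Or.inl h

/-- **THE VALUE OF THE ROW WITNESS** (`1 ≤ t`, `m ≤ t`, `1 ≤ lf i < a` for `i < t`, `t + m ≤ r`, `t + 1 ≤ r`,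
`a + r ≤ n`, `r + 1 ≤ n`): `K₄⁻`-free, `|E| + r = a (n − a)`, and the gap to the closed form is
`2 t (r − t − 1) + 2 (t − m) + (t (t − 1) − coll t lf)`. -/
theorem rowWitness_value (n a r t m : ℕ) (lf : ℕ → ℕ) (ht : 1 ≤ t) (hm : m ≤ t)
    (hlf : ∀ i, i < t → 1 ≤ lf i ∧ lf i < a) (hr : t + m ≤ r) (hr1 : t + 1 ≤ r) (han : a + r ≤ n)
    (hn : r + 1 ≤ n) :
    K4mFree (rowWitness n a r t m (by omega) lf) ∧
      (rowWitness n a r t m (by omega) lf).edgeFinset.card + r = a * (n - a) ∧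
      ∑ v, deg (rowWitness n a r t m (by omega) lf) v * deg (rowWitness n a r t m (by omega) lf) v +
          r * (n - 1 - r) + (2 * (t * (r - t - 1)) + (2 * (t - m) + (t * (t - 1) - coll t lf))) =
        (rowWitness n a r t m (by omega) lf).edgeFinset.card * n := by
  have hn0 : 0 < n := by omega
  have ha : 1 ≤ a := by have := hlf 0 (by omega); omega
  have hE := card_edges_rowWitness n a r t m hn0 lf ha hlf hr han
  refine ⟨k4mFree_rowWitness n a r t m hn0 lf, hE, ?_⟩
  have hbs := bipSub_sum_deg_sq_add_disjEdgePairs (rowWitness n a r t m hn0 lf) (leftPart n a)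
    (bipSub_rowWitness n a r t m hn0 lf) a r (card_leftPart n a (by omega))
    (by rw [Fintype.card_fin]; exact hE) (by rw [Fintype.card_fin]; exact hn)
  rw [Fintype.card_fin] at hbs
  have hid := sum_deg_sq_add_disjEdgePairs (missingGraph (rowWitness n a r t m hn0 lf) (leftPart n a))
  rw [card_edges_missingGraph_rowWitness n a r t m hn0 lf ha hlf hr han] at hid
  have hdec := sum_deg_sq_vertex_decomposition (missingGraph (rowWitness n a r t m hn0 lf) (leftPart n a))
    (fin' n hn0 0)
  rw [deg_missingGraph_rowWitness_zero n a r t m hn0 lf ha hlf hr han,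
    offEdges_missingGraph_rowWitness n a r t m hn0 lf ha hlf hr han, card_rowPairs n a r t m hn0 lf hlf hr han,
    attach_rowWitness n a r t m hn0 lf ha hlf hm hr han, offAdjPairs_rowWitness n a r t m hn0 lf ha hlf hr han] at hdec
  have hQP : coll t lf ≤ t * (t - 1) := coll_le t lf
  have h1 : t ≤ r := by omega
  have h2 : 1 ≤ r - t := by omega
  zify [h1, h2, hm, ht, hQP] at hbs hid hdec ⊢
  linear_combination hbs - hid + hdec

end C047

end TriangleCap

end PercRepro
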